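/-
Copyright (c) 2026. All rights reserved.
Released under Apache 2.0 license as described in the file LICENSE.
-/
import Summits.RiemannHypothesis.RiemannHypothesis.Theorems.HandoffLatticeNymanRH
import Summits.RiemannHypothesis.RiemannHypothesis.Theorems.HandoffLatticeNymanApprox

/-!
# THEOREM N(a): under RH the fibrewise infimum of the lattice tail is zero

`HANDOFF/prove-1` gen14, ATTEMPT-21 §8 / §8.5. Converse of THEOREM N(b)
(`riemannHypothesis_of_latticeTail_fibre`, `Theorems/HandoffLatticeNymanRH.lean`): assuming RH,
for every `ε > 0` some inner step completion `Σ_j c_j 1_{(0,b_j]}`, `0 < b_j ≤ 1/2`,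
`Σ_j c_j b_j = -1/2`, of the window datum `1_{(1/2,1]}` has lattice tail
`latticeTail 2 (fibreFn c b) < ε` (`latticeTail_fibre_of_riemannHypothesis`). With N(b) this makes
«the fibrewise infimum of the lattice tail of `1_{(1/2,1]}` is `0`» EQUIVALENT to RH.

Proof (Nyman–Beurling in the lattice coordinates). By `dilationSum_fibreFn_eq`, for admissible
`(c, b)` and `0 < u ≤ 1/2`, `-θ(u) = {1/u} - {1/(2u)} + Σ_j c_j {b_j/u}`; after `u = x/2` the
tail is `(1/2) ∫_{(0,1]} ({2/x} - {1/x} + Σ_j c_j {2b_j/x})² dx`. The piece `(c, b) = (-1, 1/2)`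
turns the datum part into `{2/x} - 2{1/x} = -1[{1/x} ≥ 1/2] =: -H(x)`
(`fract_two_mul_sub_two_mul_fract`),
and on `(0,1]`, `H = Σ_{n ≥ 0} (1_{(0,2/(2n+3)]} - 1_{(0,1/(n+2)]})`, the `n`-th term living on
`(1/(n+2), 1/(n+1)]`; truncating at `n < M` costs `≤ 1/(M+1)` in `L²(0,1]²`
(`sq_halfIndicator_sub_trunc_le`). Each `1_{(0,a]}` (`a = 2/(2n+3)`, `1/(n+2)`) is then replaced
by a MASS-ZERO Beurling combination with `β ≤ a ≤ 1` at squared `L²` cost `δ`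
(`exists_massZero_approx_of_riemannHypothesis`, the RH input via Báez-Duarte), and
`(p + q + r)² ≤ 3(p² + q² + r²)`, `(Σ_{n<M} t_n)² ≤ M Σ t_n²` give a tail
`≤ (1/2)(3/(M+1) + 6M²δ) < ε`. Total mass: `-1·1 + 0 = -1` in the `x`-variable, i.e.
`Σ c_j b_j = -1/2`. Nothing here bears on the truth of RH (everything is conditional on it).
-/

noncomputable section

set_option linter.dupNamespace false

open MeasureTheory Set Filter
open scoped ENNReal

namespace Summit.RiemannHypothesis.RiemannHypothesis.Theorems

namespace LatticeUncertainty

/-- `{2y} - 2{y} = -1[{y} ≥ 1/2]`. -/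
theorem fract_two_mul_sub_two_mul_fract (y : ℝ) :
    Int.fract (2 * y) - 2 * Int.fract y = -(if 1 / 2 ≤ Int.fract y then (1 : ℝ) else 0) := by
  have h0 := Int.fract_nonneg y
  have h1 := Int.fract_lt_one y
  have hy : 2 * y = 2 * Int.fract y + 2 * (⌊y⌋ : ℝ) := by rw [Int.fract]; ring
  split_ifs with h
  · have h2 : Int.fract (2 * y) = 2 * Int.fract y - 1 := by
      rw [Int.fract_eq_iff]
      refine ⟨by linarith, by linarith, ⟨2 * ⌊y⌋ + 1, ?_⟩⟩
      push_cast
      linarith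
    linarith
  · have h2 : Int.fract (2 * y) = 2 * Int.fract y := by
      rw [Int.fract_eq_iff]
      refine ⟨by linarith, by linarith [not_le.1 h], ⟨2 * ⌊y⌋, ?_⟩⟩
      push_cast
      linarith
    linarith

/-- Truncation of `H(x) = 1[{1/x} ≥ 1/2]` on `(0,1]`:
`H = Σ_{n<M} (1_{(0,2/(2n+3)]} - 1_{(0,1/(n+2)]})` except on `(0, 1/(M+1)]`, where the difference
is `H ∈ {0,1}`; hence `(H - Σ_{n<M} …)² ≤ 1_{(0,1/(M+1)]}`. (For `1/(m+1) < x ≤ 1/m` only the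
term `n = m - 1` is non-zero, and it equals `1[x ≤ 2/(2m+1)] = 1[1/x - m ≥ 1/2] = H(x)`.) -/
theorem sq_halfIndicator_sub_trunc_le (M : ℕ) {x : ℝ} (hx : x ∈ Ioc (0 : ℝ) 1) :
    ((if 1 / 2 ≤ Int.fract (1 / x) then (1 : ℝ) else 0) -
        ∑ n : Fin M, ((Ioc (0 : ℝ) (2 / (2 * (n : ℝ) + 3))).indicator 1 x -
          (Ioc (0 : ℝ) (1 / ((n : ℝ) + 2))).indicator 1 x)) ^ 2
      ≤ (Ioc (0 : ℝ) (1 / ((M : ℝ) + 1))).indicator (fun _ ↦ (1 : ℝ)) x := by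
  obtain ⟨hx0, hx1⟩ := hx
  set H : ℝ := if 1 / 2 ≤ Int.fract (1 / x) then (1 : ℝ) else 0 with hH
  have hH01 : H ^ 2 ≤ 1 := by rw [hH]; split_ifs <;> norm_num
  set m : ℕ := ⌊1 / x⌋₊ with hm
  have hx1' : (1 : ℝ) ≤ 1 / x := by rw [le_div_iff₀ hx0]; linarith
  have hm1 : 1 ≤ m := Nat.le_floor (by exact_mod_cast hx1')
  have hmx : (m : ℝ) ≤ 1 / x := Nat.floor_le (by positivity)
  have hmx' : 1 / x < (m : ℝ) + 1 := Nat.lt_floor_add_one _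
  have hfr : Int.fract (1 / x) = 1 / x - (m : ℝ) := by
    rw [Int.fract, hm, natCast_floor_eq_intCast_floor (by positivity)]
  -- each term of the truncated sum
  have hterm : ∀ n : Fin M, (Ioc (0 : ℝ) (2 / (2 * (n : ℝ) + 3))).indicator (1 : ℝ → ℝ) x -
      (Ioc (0 : ℝ) (1 / ((n : ℝ) + 2))).indicator 1 x = if (n : ℕ) + 1 = m then H else 0 := by
    intro n
    have hn0 : (0 : ℝ) ≤ (n : ℕ) := (n : ℕ).cast_nonneg
    by_cases hn : (n : ℕ) + 1 = m
    · rw [if_pos hn]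
      have hnm : ((n : ℕ) : ℝ) + 1 = (m : ℝ) := by exact_mod_cast hn
      -- second indicator vanishes: `1/(n+2) < x`
      have h2 : x ∉ Ioc (0 : ℝ) (1 / ((n : ℝ) + 2)) := by
        rintro ⟨-, h⟩
        rw [le_div_iff₀ (by positivity)] at h
        rw [div_lt_iff₀ hx0] at hmx'
        nlinarith
      rw [indicator_of_notMem h2, sub_zero, hH, hfr]
      by_cases h3 : x ≤ 2 / (2 * (n : ℝ) + 3)
      · rw [indicator_of_mem (mem_Ioc.2 ⟨hx0, h3⟩), Pi.one_apply, if_pos]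
        rw [le_div_iff₀ (by positivity)] at h3
        rw [le_sub_iff_add_le, le_div_iff₀ hx0]
        nlinarith
      · rw [indicator_of_notMem (fun h ↦ h3 h.2), if_neg]
        rw [not_le] at h3 ⊢
        rw [div_lt_iff₀ (by positivity)] at h3
        rw [sub_lt_iff_lt_add, div_lt_iff₀ hx0]
        nlinarith
    · rw [if_neg hn]
      by_cases h2 : x ≤ 1 / ((n : ℝ) + 2)
      · have h3 : x ≤ 2 / (2 * (n : ℝ) + 3) := by
          refine h2.trans ?_
          rw [div_le_div_iff₀ (by positivity) (by positivity)]
          nlinarith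
        rw [indicator_of_mem (mem_Ioc.2 ⟨hx0, h3⟩), indicator_of_mem (mem_Ioc.2 ⟨hx0, h2⟩),
          sub_self]
      · have h3 : ¬ x ≤ 2 / (2 * (n : ℝ) + 3) := by
          intro h3
          apply hn
          -- `n + 3/2 ≤ 1/x < n + 2` forces `⌊1/x⌋₊ = n + 1`
          rw [not_le, div_lt_iff₀ (by positivity)] at h2
          rw [le_div_iff₀ (by positivity)] at h3
          rw [hm, eq_comm, Nat.floor_eq_iff (by positivity)]
          push_cast
          constructor
          · rw [le_div_iff₀ hx0]; nlinarith
          · rw [div_lt_iff₀ hx0]; nlinarith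
        rw [indicator_of_notMem (fun h ↦ h3 h.2), indicator_of_notMem (fun h ↦ h2 h.2), sub_self]
  rw [Finset.sum_congr rfl fun n _ ↦ hterm n]
  by_cases hmM : m ≤ M
  · -- the sum is `H`, attained at `n = m - 1`
    have hsum : ∑ n : Fin M, (if (n : ℕ) + 1 = m then H else 0) = H := by
      rw [Finset.sum_eq_single ⟨m - 1, by omega⟩]
      · simp only
        rw [if_pos (by omega)]
      · intro n _ hn
        rw [if_neg]
        intro h
        apply hn
        ext
        simp only
        omega
      · intro h; exact absurd (Finset.mem_univ _) h
    rw [hsum, sub_self, zero_pow two_ne_zero]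
    exact indicator_nonneg (fun _ _ ↦ zero_le_one) _
  · -- `m > M`: every term vanishes and `x ≤ 1/m ≤ 1/(M+1)`
    have hsum : ∑ n : Fin M, (if (n : ℕ) + 1 = m then H else 0) = 0 := by
      refine Finset.sum_eq_zero fun n _ ↦ ?_
      rw [if_neg]
      have := n.2
      omega
    rw [hsum, sub_zero]
    have hxM : x ∈ Ioc (0 : ℝ) (1 / ((M : ℝ) + 1)) := by
      refine ⟨hx0, ?_⟩
      rw [le_div_iff₀ (by positivity)]
      rw [le_div_iff₀ hx0] at hmx
      have : (M : ℝ) + 1 ≤ m := by exact_mod_cast Nat.lt_of_not_le hmM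
      nlinarith
    rw [indicator_of_mem hxM]
    exact hH01

/-- Change of variables `u = x/2`: `∫_{(0,1/2]} g(2u) du = (1/2) ∫_{(0,1]} g(x) dx`. -/
theorem integral_comp_two_mul_Ioc (g : ℝ → ℝ) :
    ∫ u in Ioc (0 : ℝ) (1 / 2), g (2 * u) = 1 / 2 * ∫ x in Ioc (0 : ℝ) 1, g x := by
  rw [← intervalIntegral.integral_of_le (by norm_num : (0 : ℝ) ≤ 1 / 2),
    intervalIntegral.integral_comp_mul_left (f := g) two_ne_zero,
    ← one_div, mul_zero, mul_one_div_cancel two_ne_zero,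
    intervalIntegral.integral_of_le zero_le_one, smul_eq_mul]

/-- ★ **THEOREM N(a).** Under RH, for every `ε > 0` the window datum `1_{(1/2,1]}` admits an inner
step completion of mass `-1/2` (so that the completed even function is in `𝒮₀`'s step closure:
`f(0) = 0 = ∫ f`) whose lattice tail is `< ε`. Converse of
`riemannHypothesis_of_latticeTail_fibre`. [cite: BaezDuarte2003, Thm. 1.1] -/
theorem latticeTail_fibre_of_riemannHypothesis (hRH : RiemannHypothesis) {ε : ℝ} (hε : 0 < ε) :
    ∃ (n : ℕ) (c : Fin n → ℂ) (b : Fin n → ℝ), (∀ j, 0 < b j ∧ b j ≤ 1 / 2) ∧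
      (∑ j, c j * (b j : ℂ) = -(1 / 2 : ℂ)) ∧ latticeTail 2 (fibreFn c b) < ε := by
  -- truncation level `M` and accuracy `δ`
  obtain ⟨M, hM⟩ : ∃ M : ℕ, 6 / ε ≤ (M : ℝ) := exists_nat_ge (6 / ε)
  have hM1 : 3 / ((M : ℝ) + 1) < ε / 2 := by
    have h6 : 6 ≤ (M : ℝ) * ε := by rwa [div_le_iff₀ hε] at hM
    rw [div_lt_iff₀ (by positivity)]
    nlinarith
  set δ : ℝ := ε / (12 * ((M : ℝ) ^ 2 + 1)) with hδ
  have hδ0 : 0 < δ := by positivity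
  have hδ1 : 6 * (M : ℝ) ^ 2 * δ ≤ ε / 2 := by
    rw [hδ, mul_div_assoc', div_le_iff₀ (by positivity)]
    nlinarith
  -- mass-zero approximants of `1_{(0,2/(2n+3)]}` and `1_{(0,1/(n+2)]}`, `n < M`
  have hap : ∀ n : Fin M, (0 : ℝ) < 2 / (2 * (n : ℝ) + 3) ∧ 2 / (2 * (n : ℝ) + 3) ≤ 1 := fun n ↦
    ⟨by positivity, by rw [div_le_one (by positivity)]; linarith [(n : ℕ).cast_nonneg (α := ℝ)]⟩
  have ham : ∀ n : Fin M, (0 : ℝ) < 1 / ((n : ℝ) + 2) ∧ 1 / ((n : ℝ) + 2) ≤ 1 := fun n ↦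
    ⟨by positivity, by rw [div_le_one (by positivity)]; linarith [(n : ℕ).cast_nonneg (α := ℝ)]⟩
  choose Np cp βp hβp hmp hIp using fun n : Fin M ↦
    exists_massZero_approx_of_riemannHypothesis hRH (hap n).1 (hap n).2 hδ0
  choose Nm cm βm hβm hmm hIm using fun n : Fin M ↦
    exists_massZero_approx_of_riemannHypothesis hRH (ham n).1 (ham n).2 hδ0
  -- the real family `(γ, β)` in the `x`-variable: `(-1, 1)`, the `(cp n, βp n)` and the
  -- `(-cm n, βm n)`, packaged over one finite index type
  obtain ⟨ι, hι, γ, β, hβ, hmass, hfam⟩ : ∃ (ι : Type) (_ : Fintype ι) (γ β : ι → ℝ),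
      (∀ i, 0 < β i ∧ β i ≤ 1) ∧ (∑ i, γ i * β i = -1) ∧
      ∀ x : ℝ, ∑ i, γ i * Int.fract (β i / x) = -Int.fract (1 / x)
        + ∑ n, ∑ k, cp n k * Int.fract (βp n k / x)
        - ∑ n, ∑ k, cm n k * Int.fract (βm n k / x) := by
    refine ⟨Unit ⊕ ((Σ n : Fin M, Fin (Np n)) ⊕ (Σ n : Fin M, Fin (Nm n))), inferInstance,
      Sum.elim (fun _ ↦ -1) (Sum.elim (fun p ↦ cp p.1 p.2) (fun p ↦ -cm p.1 p.2)),
      Sum.elim (fun _ ↦ 1) (Sum.elim (fun p ↦ βp p.1 p.2) (fun p ↦ βm p.1 p.2)), ?_, ?_, ?_⟩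
    · rintro (_ | ⟨n, k⟩ | ⟨n, k⟩)
      · simp
      · exact ⟨(hβp n k).1, (hβp n k).2.trans (hap n).2⟩
      · exact ⟨(hβm n k).1, (hβm n k).2.trans (ham n).2⟩
    · simp [Fintype.sum_sum_type, Fintype.sum_sigma, hmp, hmm]
    · intro x
      simp only [Fintype.sum_sum_type, Sum.elim_inl, Sum.elim_inr, Fintype.sum_sigma,
        Finset.univ_unique, Finset.sum_singleton, neg_mul, one_mul, Finset.sum_neg_distrib]
      ring
  let e := Fintype.equivFin ι
  set c : Fin (Fintype.card ι) → ℂ := fun j ↦ (γ (e.symm j) : ℂ) with hc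
  set b : Fin (Fintype.card ι) → ℝ := fun j ↦ β (e.symm j) / 2 with hb
  have hb' : ∀ j, 0 < b j ∧ b j ≤ 1 / 2 := fun j ↦
    ⟨by simp only [hb]; linarith [(hβ (e.symm j)).1],
      by simp only [hb]; linarith [(hβ (e.symm j)).2]⟩
  have hmassC : ∑ j, c j * (b j : ℂ) = -(1 / 2 : ℂ) := by
    have h1 : ∑ j, c j * (b j : ℂ) = ∑ i, (γ i : ℂ) * ((β i / 2 : ℝ) : ℂ) :=
      e.symm.sum_comp (fun i ↦ (γ i : ℂ) * ((β i / 2 : ℝ) : ℂ))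
    have h2 : ∑ i, (γ i : ℂ) * ((β i / 2 : ℝ) : ℂ) = (((1 / 2 : ℝ) * ∑ i, γ i * β i : ℝ) : ℂ) := by
      push_cast
      rw [Finset.mul_sum]
      exact Finset.sum_congr rfl fun i _ ↦ by ring
    rw [h1, h2, hmass]
    push_cast
    ring
  refine ⟨Fintype.card ι, c, b, hb', hmassC, ?_⟩
  -- the objects of the estimate
  set E : ℝ → ℝ := fun x ↦ Int.fract (2 / x) - Int.fract (1 / x) + ∑ i, γ i * Int.fract (β i / x)
    with hE
  set HM : ℝ → ℝ := fun x ↦ ∑ n : Fin M, ((Ioc (0 : ℝ) (2 / (2 * (n : ℝ) + 3))).indicator 1 x -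
    (Ioc (0 : ℝ) (1 / ((n : ℝ) + 2))).indicator 1 x) with hHM
  set dp : Fin M → ℝ → ℝ := fun n x ↦ (Ioc (0 : ℝ) (2 / (2 * (n : ℝ) + 3))).indicator 1 x -
    ∑ k, cp n k * Int.fract (βp n k / x) with hdp
  set dm : Fin M → ℝ → ℝ := fun n x ↦ (Ioc (0 : ℝ) (1 / ((n : ℝ) + 2))).indicator 1 x -
    ∑ k, cm n k * Int.fract (βm n k / x) with hdm
  set U : ℝ → ℝ := fun x ↦ 3 * (Ioc (0 : ℝ) (1 / ((M : ℝ) + 1))).indicator (fun _ ↦ (1 : ℝ)) x +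
    3 * M * ∑ n, dp n x ^ 2 + 3 * M * ∑ n, dm n x ^ 2 with hU
  -- (1) the tail as an integral of `E²` over `(0,1]`
  have hR : ∀ u : ℝ, 0 < u →
      ((Int.fract (1 / u) : ℝ) : ℂ) - ((Int.fract ((1 / 2) / u) : ℝ) : ℂ)
        + ∑ j, c j * ((Int.fract (b j / u) : ℝ) : ℂ) = ((E (2 * u) : ℝ) : ℂ) := by
    intro u hu
    have hu0 : u ≠ 0 := hu.ne'
    have hsum : ∑ j, c j * ((Int.fract (b j / u) : ℝ) : ℂ)
        = ∑ i, (γ i : ℂ) * ((Int.fract (β i / (2 * u)) : ℝ) : ℂ) := by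
      rw [← e.symm.sum_comp (fun i ↦ (γ i : ℂ) * ((Int.fract (β i / (2 * u)) : ℝ) : ℂ))]
      refine Finset.sum_congr rfl fun j _ ↦ ?_
      simp only [hc, hb, div_div]
    have h1 : (1 : ℝ) / u = 2 / (2 * u) := by field_simp
    have h2 : (1 : ℝ) / 2 / u = 1 / (2 * u) := by rw [div_div]
    rw [hsum, h1, h2, hE]
    push_cast
    rfl
  have htail : latticeTail 2 (fibreFn c b) = 1 / 2 * ∫ x in Ioc (0 : ℝ) 1, E x ^ 2 := by
    rw [← integral_comp_two_mul_Ioc (fun x ↦ E x ^ 2)]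
    unfold latticeTail
    refine setIntegral_congr_fun measurableSet_Ioc fun u hu ↦ ?_
    rw [dilationSum_fibreFn_eq c b hb' hmassC hu.1, norm_neg, hR u hu.1, Complex.norm_real,
      Real.norm_eq_abs, sq_abs]
  -- (2) the pointwise decomposition of `E`
  have hEq : ∀ x : ℝ, E x = -((if 1 / 2 ≤ Int.fract (1 / x) then (1 : ℝ) else 0) - HM x)
      - ∑ n, dp n x + ∑ n, dm n x := by
    intro x
    have hL := fract_two_mul_sub_two_mul_fract (1 / x)
    rw [mul_one_div] at hL
    have hHMx : HM x = ∑ n : Fin M, (Ioc (0 : ℝ) (2 / (2 * (n : ℝ) + 3))).indicator 1 x -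
        ∑ n : Fin M, (Ioc (0 : ℝ) (1 / ((n : ℝ) + 2))).indicator 1 x := by
      simp only [hHM, Finset.sum_sub_distrib]
    have hdpx : ∑ n, dp n x = ∑ n : Fin M, (Ioc (0 : ℝ) (2 / (2 * (n : ℝ) + 3))).indicator 1 x -
        ∑ n, ∑ k, cp n k * Int.fract (βp n k / x) := by
      simp only [hdp, Finset.sum_sub_distrib]
    have hdmx : ∑ n, dm n x = ∑ n : Fin M, (Ioc (0 : ℝ) (1 / ((n : ℝ) + 2))).indicator 1 x -
        ∑ n, ∑ k, cm n k * Int.fract (βm n k / x) := by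
      simp only [hdm, Finset.sum_sub_distrib]
    rw [hHMx, hdpx, hdmx]
    simp only [hE, hfam x]
    linarith
  -- (3) the pointwise bound `E² ≤ U` on `(0,1]`
  have hEU : ∀ x ∈ Ioc (0 : ℝ) 1, E x ^ 2 ≤ U x := by
    intro x hx
    have h3 : E x ^ 2 ≤ 3 * ((if 1 / 2 ≤ Int.fract (1 / x) then (1 : ℝ) else 0) - HM x) ^ 2
        + 3 * (∑ n, dp n x) ^ 2 + 3 * (∑ n, dm n x) ^ 2 := by
      rw [hEq x]
      nlinarith [sq_nonneg (((if 1 / 2 ≤ Int.fract (1 / x) then (1 : ℝ) else 0) - HM x)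
          - ∑ n, dp n x), sq_nonneg (((if 1 / 2 ≤ Int.fract (1 / x) then (1 : ℝ) else 0) - HM x)
          + ∑ n, dm n x), sq_nonneg (∑ n, dp n x + ∑ n, dm n x)]
    have hT := sq_halfIndicator_sub_trunc_le M hx
    have hCSp : (∑ n, dp n x) ^ 2 ≤ M * ∑ n, dp n x ^ 2 := by
      have := sq_sum_le_card_mul_sum_sq (s := Finset.univ) (f := fun n : Fin M ↦ dp n x)
      simpa [Finset.card_univ, Fintype.card_fin] using this
    have hCSm : (∑ n, dm n x) ^ 2 ≤ M * ∑ n, dm n x ^ 2 := by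
      have := sq_sum_le_card_mul_sum_sq (s := Finset.univ) (f := fun n : Fin M ↦ dm n x)
      simpa [Finset.card_univ, Fintype.card_fin] using this
    simp only [hHM] at h3
    simp only [hU]
    nlinarith
  -- (4) integrability and the integral of `U`
  have hIind : IntegrableOn (fun x : ℝ ↦ (Ioc (0 : ℝ) (1 / ((M : ℝ) + 1))).indicator
      (fun _ ↦ (1 : ℝ)) x) (Ioc 0 1) :=
    (integrableOn_const (by simp)).indicator measurableSet_Ioc
  have hIdp : ∀ n, IntegrableOn (fun x ↦ dp n x ^ 2) (Ioc 0 1) := fun n ↦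
    integrableOn_defect_sq _ (cp n) (βp n) 1
  have hIdm : ∀ n, IntegrableOn (fun x ↦ dm n x ^ 2) (Ioc 0 1) := fun n ↦
    integrableOn_defect_sq _ (cm n) (βm n) 1
  have hIsp : IntegrableOn (fun x ↦ ∑ n, dp n x ^ 2) (Ioc 0 1) :=
    integrable_finsetSum _ fun n _ ↦ hIdp n
  have hIsm : IntegrableOn (fun x ↦ ∑ n, dm n x ^ 2) (Ioc 0 1) :=
    integrable_finsetSum _ fun n _ ↦ hIdm n
  have hA : IntegrableOn (fun x : ℝ ↦ 3 * (Ioc (0 : ℝ) (1 / ((M : ℝ) + 1))).indicator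
      (fun _ ↦ (1 : ℝ)) x + 3 * M * ∑ n, dp n x ^ 2) (Ioc 0 1) :=
    (hIind.const_mul 3).add (hIsp.const_mul (3 * M))
  have hIU : IntegrableOn U (Ioc 0 1) := by
    simp only [hU]
    exact hA.add (hIsm.const_mul (3 * M))
  have hind : ∫ x in Ioc (0 : ℝ) 1, (Ioc (0 : ℝ) (1 / ((M : ℝ) + 1))).indicator
      (fun _ ↦ (1 : ℝ)) x = 1 / ((M : ℝ) + 1) := by
    rw [integral_indicator measurableSet_Ioc, Measure.restrict_restrict measurableSet_Ioc,
      setIntegral_const, smul_eq_mul, mul_one, measureReal_def,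
      inter_eq_left.2 (Ioc_subset_Ioc_right ((div_le_one (by positivity)).2 (by linarith))),
      Real.volume_Ioc, sub_zero, ENNReal.toReal_ofReal (by positivity)]
  have hUint : ∫ x in Ioc (0 : ℝ) 1, U x
      = 3 * (1 / ((M : ℝ) + 1)) + 3 * M * (∑ n, ∫ x in Ioc (0 : ℝ) 1, dp n x ^ 2)
        + 3 * M * (∑ n, ∫ x in Ioc (0 : ℝ) 1, dm n x ^ 2) := by
    have i1 : ∫ x in Ioc (0 : ℝ) 1, U x = (∫ x in Ioc (0 : ℝ) 1,
        (3 * (Ioc (0 : ℝ) (1 / ((M : ℝ) + 1))).indicator (fun _ ↦ (1 : ℝ)) x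
          + 3 * M * ∑ n, dp n x ^ 2)) + ∫ x in Ioc (0 : ℝ) 1, 3 * M * ∑ n, dm n x ^ 2 := by
      simp only [hU]
      exact integral_add hA (hIsm.const_mul (3 * M))
    have i2 : ∫ x in Ioc (0 : ℝ) 1, (3 * (Ioc (0 : ℝ) (1 / ((M : ℝ) + 1))).indicator
        (fun _ ↦ (1 : ℝ)) x + 3 * M * ∑ n, dp n x ^ 2)
          = (∫ x in Ioc (0 : ℝ) 1, 3 * (Ioc (0 : ℝ) (1 / ((M : ℝ) + 1))).indicator
              (fun _ ↦ (1 : ℝ)) x) + ∫ x in Ioc (0 : ℝ) 1, 3 * M * ∑ n, dp n x ^ 2 :=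
      integral_add (hIind.const_mul 3) (hIsp.const_mul (3 * M))
    have i3 : ∫ x in Ioc (0 : ℝ) 1, ∑ n, dp n x ^ 2 = ∑ n, ∫ x in Ioc (0 : ℝ) 1, dp n x ^ 2 :=
      integral_finsetSum _ fun n _ ↦ hIdp n
    have i4 : ∫ x in Ioc (0 : ℝ) 1, ∑ n, dm n x ^ 2 = ∑ n, ∫ x in Ioc (0 : ℝ) 1, dm n x ^ 2 :=
      integral_finsetSum _ fun n _ ↦ hIdm n
    rw [i1, i2, integral_const_mul, integral_const_mul, integral_const_mul, hind, i3, i4]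
  have hUle : ∫ x in Ioc (0 : ℝ) 1, U x ≤ 3 / ((M : ℝ) + 1) + 6 * (M : ℝ) ^ 2 * δ := by
    rw [hUint, mul_one_div]
    have hsp : ∑ n, ∫ x in Ioc (0 : ℝ) 1, dp n x ^ 2 ≤ M * δ := by
      calc ∑ n, ∫ x in Ioc (0 : ℝ) 1, dp n x ^ 2 ≤ ∑ _n : Fin M, δ :=
            Finset.sum_le_sum fun n _ ↦ hIp n
        _ = M * δ := by simp
    have hsm : ∑ n, ∫ x in Ioc (0 : ℝ) 1, dm n x ^ 2 ≤ M * δ := by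
      calc ∑ n, ∫ x in Ioc (0 : ℝ) 1, dm n x ^ 2 ≤ ∑ _n : Fin M, δ :=
            Finset.sum_le_sum fun n _ ↦ hIm n
        _ = M * δ := by simp
    have hM0 : (0 : ℝ) ≤ 3 * M := by positivity
    nlinarith [mul_le_mul_of_nonneg_left hsp hM0, mul_le_mul_of_nonneg_left hsm hM0]
  -- (5) conclusion
  have hEle : ∫ x in Ioc (0 : ℝ) 1, E x ^ 2 ≤ ∫ x in Ioc (0 : ℝ) 1, U x := by
    refine integral_mono_of_nonneg (Eventually.of_forall fun x ↦ sq_nonneg _) hIU ?_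
    filter_upwards [ae_restrict_mem measurableSet_Ioc] with x hx using hEU x hx
  rw [htail]
  have h1 : ∫ x in Ioc (0 : ℝ) 1, E x ^ 2 < ε := by linarith
  have h2 : 0 ≤ ∫ x in Ioc (0 : ℝ) 1, E x ^ 2 := integral_nonneg fun x ↦ sq_nonneg _
  linarith

/-- ★★ **THEOREM N (fibre form of Nyman–Beurling, both halves).** The Riemann hypothesis holds
iff the window datum `1_{(1/2,1]}` admits inner step completions of mass `-1/2` with arbitrarily
small lattice tail: `RH ⟺ inf {latticeTail 2 (fibreFn c b) : 0 < b_j ≤ 1/2, Σ c_j b_j = -1/2} = 0`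
(N(a) = `latticeTail_fibre_of_riemannHypothesis`, N(b) = `riemannHypothesis_of_latticeTail_fibre`).
[cite: BaezDuarte2003, Thm. 1.1] -/
theorem riemannHypothesis_iff_latticeTail_fibre :
    RiemannHypothesis ↔ ∀ ε : ℝ, 0 < ε → ∃ (n : ℕ) (c : Fin n → ℂ) (b : Fin n → ℝ),
      (∀ j, 0 < b j ∧ b j ≤ 1 / 2) ∧ (∑ j, c j * (b j : ℂ) = -(1 / 2 : ℂ)) ∧
        latticeTail 2 (fibreFn c b) < ε :=
  ⟨fun h _ hε ↦ latticeTail_fibre_of_riemannHypothesis h hε,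
    riemannHypothesis_of_latticeTail_fibre⟩

end LatticeUncertainty

end Summit.RiemannHypothesis.RiemannHypothesis.Theorems

end
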